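import Summits.QuantumFields.BalabanUV.T4Continuum.Support.NE9EvaluationChannel
import Summits.QuantumFields.BalabanUV.T4Continuum.Support.NE9LastCouplingBridge

/-!
# NE9EvalChannelCouplingModulus — the CHANNEL COUPLING MODULUS binder `hTcup` (skeleton leaf A3, weighted ∕ localized form
(R-4)) DERIVED for every EVALUATION–INTEGRAL channel from a background-Lipschitz modulus of the old terms
(`T4OutputRate.LipBackground` BY NAME) and ONE kernel SHIFT-MASS inequality (cell `pub-balaban`, T4-DAG §2 node U3 ∕ §6 NE9;
NE9 formalisation swarm, unit `b2b-balaban-t4-ne9-formalise-leaf-03` gen 3; skeleton `HOME/t4/b2b-balaban-t4-ne9-p1/SKELETON-NE9-P1.md`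
v1.3.3 §3 row A3: «GLOBAL kernel form g17 … (old action's background-Lipschitz constant × shift per unit coupling); WEIGHTED ∕
LOCALIZED form (with the (1.36) weight `wt k y`): TYPED — OPEN = (R-4)»)

HONEST FRAMING (T4-DAG PAGE 1).  Rung (B)+1 on a FIXED finite torus — NOT infinite volume, NOT a mass gap, NOT the Clay
problem.  NE9 (`T4OutputRate.NE9` ∧ `FadingMemory`) is a cell NEW ESTIMATE, NOT PRINTED, and is NOT discharged here.
Everything below is bookkeeping over the ABSTRACT carriers of `T4OutputRate` and the co-owner's abstract evaluation–integral
channel `NE9EvaluationChannel.evalChannel` (P2-F2); every analytic input is a DISPLAYED binder stated INLINE — no Prop-valued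
definition is introduced (trigger c3: leaf A3's INSTANCE for Bałaban's channel (1.33) stays a displayed TYPE statement; this
file types the REDUCTION only).  [I] = [Balaban1987RG1], [II] = [Balaban1988RG2Cluster], [III] = [Balaban1988Convergent] are
quoted for TYPES only (ABSOLUTE RULE).  `FlowStep.BetaPertH`, (B), (B^μ) do not occur.

WHERE THIS SITS.  Every END face of the row (END-B `NE9LastCouplingBridge.ne9_and_fadingMemory_of_couplingTwoPoint`, END-V,
END-S, the `NE9MarginalProjectionEnd` faces, `Spine/NE9/CarriersOfRecordFaces`) displays
`hTcup : ∀ g g′ ∈ W, ∀ k y, |T k g (E g) y − T k g′ (E g) y| ≤ wt k y·(qT k·|g k − g′ k|)` — the step-k channel at two COUPLING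
ARGUMENTS on the SAME old terms (leaf A3; instance O-NE9-5).  In print the coupling enters the channel as the AMPLITUDE of a
background shift: the curly bracket of [I] (2.12) p. 268 «{𝐄_k(U_k(exp i[g_kCB − hD̃(g_kCB)]V^{(k)})) − 𝐄_k(U_k(V^{(k)}))}» reads the
old action at a background moved by the fluctuation field («the expression under the exponential above vanishes at g_k = 0»,
p. 268), and the localized pieces (1.23) p. 7 of [II] are Cauchy integrals — coupling-free weights `dt_□∕t_□²`,
`dσ(Δ)∕(σ(Δ) − s(Δ))²` — of «𝐄(□₀, (tζ̃_□ + t_□ζ_□)𝐇_k(σ(Y₀), B′))», the old term EVALUATED at a background carrying the shift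
function, of size «|𝐇_k(s(Y₀), B′)| ≤ 4B₀C₁e^{16κ₁}g_k|B|» ((1.21) p. 7).  The owner's (w5) `NE9ChannelCouplingDeriv` supplies
`hTcup` from an inline amplitude-DERIVATIVE bound on an opaque function (mean value theorem).  THIS LEAF is the twin, for leaf
A3, of P2-F2's `NE9EvaluationChannel.channelSizeAtStepNN_of_kernelMass` for leaf S5: for an evaluation–integral channel with a
COUPLING-FREE kernel (source families `F₀ k y`, parameter measures `ν₀ k y`, weights `w₀ k y`) and COUPLING-SHIFTED evaluated
backgrounds `bg k s y X ω`, the clause `hTcup` FOLLOWS — no derivative — from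
 (i)  a background modulus of the family the channel reads, in the `e^{−κd}` currency — for the terms on run-A backgrounds this is
      node U3's printed-ingredient bracket `T4OutputRate.LipBackground E W κ CU` BY NAME ([III] (2.27)(ii) + Cauchy, displayed
      there, NOT carried out) with `CU g j ≤ CUbar`;
 (ii) ONE displayed SHIFT bound `gauge (bg k g y X ω) (bg k g′ y X ω) ≤ amp k y X ω·|g k − g′ k|` (the evaluated background moves
      Lipschitz-ly in the amplitude; the comparison history enters the step-k kernel only through its k-th coupling — the
      STRUCTURE of [I] (2.12)∕(2.13));
 (iii) ONE kernel SHIFT-MASS inequality `Σ_{X ∈ F₀ k y} e^{−κd(X)}·∫ |w₀ k y X ω|·amp k y X ω ∂ν₀ ≤ wt k y·qA k` (TYPE: (1.24) p. 7 =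
      weight mass × shift size «g_k|B|» × term size, with the (1.36) weight),
with `qT k := CUbar·qA k`.  The conclusion is LITERALLY the `hTcup` clause, so it feeds every END face WITHOUT re-wiring (§3
shows END-B; the sibling `NE9EvalChannelCouplingModulusProj` treats the owner's v1.3 dictionary `T := 𝒯 ∘ P`).
NOT PRINTED and not claimed: that Bałaban's (1.33) IS such a channel with THESE shift masses (instance O-NE9-5, gated on the
model O-NE9-1).  Typing remark (recorded, not adjudicated): in print the t_□-contour (1.22) has a g_k-dependent radius; the
coupling-free-kernel form is a TYPING CHOICE for O-NE9-1 (a fixed admissible contour represents the same t_□-derivative at 0).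
DISGUISE TEST: last coupling only, SAME old terms, one output index — a regularity property of a LINEAR channel in its
amplitude parameter; no history, no renormalised term; not NE9 (§4: coupling-FREE terms already give `qT ≠ 0`).

WHAT IS PROVED (kernel, `[folklore]` bookkeeping; 0 sorry, 0 `def`).
§1 `abs_integral_mul_sub_le_of_shift`, `abs_evalChannel_sub_le_of_shift` (ANY family with an inline background modulus along
   the evaluation family; any `Bg`, any real gauge), **`channelCouplingModulus_eval`** (= the `hTcup` clause for a
   history-indexed family `H g`, in particular `H = E`).
§2 **`channelCouplingModulus_eval_of_lipBackground`** (`Bg = C.BgA`, `T4OutputRate.LipBackground` BY NAME).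
§3 END face **`ne9_and_fadingMemory_of_couplingTwoPoint_evalChannel`** = END-B BY NAME at `T := evalChannel …`, the five channel
   binders replaced by P2-F2's `hE`∕`hF`∕`hw`∕`hmass`, and `hqT0`∕`hTcup`∕`hqTb` by (i)(ii)(iii); conclusion = END-B's with
   `qTbar := CUbar·qAbar`.
§4 non-vacuity with a GENUINE shift (toy carriers, backgrounds `ℝ`, gauge `|U − U′|`, coupling-free terms `sin U`, one source
   domain read at the background `g k`): the output difference IS `sin(g k) − sin(g′ k)`, and §1 gives the clause with `qT = 1`.

References (TYPES only): [Balaban1987RG1] CMP 109 (1987) (2.12)–(2.14) p. 268; [Balaban1988RG2Cluster] CMP 116 (1988) (1.21)–(1.24) p. 7, (1.33)–(1.36) p. 9; [Balaban1988Convergent] CMP 119 (1988) (2.27)(ii)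
p. 259 (through `LipBackground`).
-/

noncomputable section

namespace Summit.QuantumFields.BalabanUV.T4Continuum.NE9EvalChannelCouplingModulus

open scoped BigOperators
open MeasureTheory
open Literature.MathematicalPhysics.QuantumFieldTheory.Balaban1983to89
open Literature.MathematicalPhysics.QuantumFieldTheory.Balaban1983to89.T4OutputRate
open Literature.MathematicalPhysics.QuantumFieldTheory.Balaban1983to89.T4HistoryLipschitzRecursion
open Literature.MathematicalPhysics.QuantumFieldTheory.Balaban1983to89.T4HistoryLipschitzOuter
open Literature.MathematicalPhysics.QuantumFieldTheory.Balaban1983to89.T4HistoryLipschitzActivity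
open Literature.MathematicalPhysics.QuantumFieldTheory.Balaban1983to89.T4HistoryLipschitzActivity (ClusterGeom)
open Literature.MathematicalPhysics.QuantumFieldTheory.Balaban1983to89.T4HistoryLipschitzSegment
open Summit.QuantumFields.BalabanUV.T4Continuum.NE9EvaluationChannel
open Summit.QuantumFields.BalabanUV.T4Continuum.NE9LastCouplingBridge

variable {C : Carriers} {Bg ι : Type} {Ω : Type*} [MeasurableSpace Ω]

/-! ## §1 The coupling modulus of an evaluation–integral channel from a background modulus and a shift bound -/

/-- Elementary, one source domain: if `|f ω − f′ ω| ≤ M·amp ω` pointwise with `M ≥ 0`, the weight times `f`, `f′` is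
integrable and `|w|·amp` is integrable, then `|∫ w·f − ∫ w·f′| ≤ (∫ |w|·amp)·M`. [folklore] -/
theorem abs_integral_mul_sub_le_of_shift {μ : Measure Ω} {w amp f f' : Ω → ℝ} {M : ℝ}
    (hf : Integrable (fun ω => w ω * f ω) μ) (hf' : Integrable (fun ω => w ω * f' ω) μ)
    (hwa : Integrable (fun ω => |w ω| * amp ω) μ) (hd : ∀ ω, |f ω - f' ω| ≤ M * amp ω) :
    |(∫ ω, w ω * f ω ∂μ) - ∫ ω, w ω * f' ω ∂μ| ≤ (∫ ω, |w ω| * amp ω ∂μ) * M := by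
  have key : (∫ ω, w ω * f ω ∂μ) - ∫ ω, w ω * f' ω ∂μ = ∫ ω, (w ω * f ω - w ω * f' ω) ∂μ :=
    (integral_sub hf hf').symm
  rw [key]
  have h1 : |∫ ω, (w ω * f ω - w ω * f' ω) ∂μ| ≤ ∫ ω, |w ω| * amp ω * M ∂μ := by
    rw [← Real.norm_eq_abs]
    refine norm_integral_le_of_norm_le (hwa.mul_const M) (Filter.Eventually.of_forall fun ω => ?_)
    rw [Real.norm_eq_abs, ← mul_sub, abs_mul, mul_assoc]
    refine mul_le_mul_of_nonneg_left ?_ (abs_nonneg _)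
    rw [mul_comm]
    exact hd ω
  rwa [integral_mul_const] at h1

/-- **THE COUPLING MODULUS OF AN EVALUATION–INTEGRAL CHANNEL, ANY FAMILY (kernel).**  Channel: coupling-free kernel (source
families `F₀ k y`, parameter measures `ν₀ k y`, weights `w₀ k y`) and evaluated backgrounds `bg k s y X ω` depending on the
comparison history `s`.  DISPLAYED (inline, asserted nowhere for Bałaban's objects): a background modulus of the family `H`
along the step-k∕index-y evaluation family in the `e^{−κd}` currency w.r.t. a real gauge on the backgrounds (`hH`, constant
`M ≥ 0`), integrability of the weighted evaluations at both histories and of `|w₀|·amp`, and the SHIFT bound `hshift` (the two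
histories' evaluated backgrounds are `amp·|s k − s′ k|`-close in the gauge).  CONCLUSION: the channel outputs of `H` at the two
histories differ by at most (decay-weighted shift mass of the kernel) × `M·|s k − s′ k|`.  Printed TYPE of the shift:
[I] (2.12) p. 268; of the mass: [II] (1.21)∕(1.24) p. 7.
[cite: Balaban1987RG1, (2.12)-(2.13) p.268; Balaban1988RG2Cluster, (1.21)-(1.24) p.7] -/
theorem abs_evalChannel_sub_le_of_shift {F₀ : ℕ → ι → Finset C.Dom} {ν₀ : ℕ → ι → C.Dom → Measure Ω}
    {w₀ : ℕ → ι → C.Dom → Ω → ℝ} {bg : ℕ → (ℕ → ℝ) → ι → C.Dom → Ω → Bg} (gauge : Bg → Bg → ℝ)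
    {amp : ℕ → ι → C.Dom → Ω → ℝ} {κ M : ℝ} {H : Bg → C.Dom → ℝ} {s s' : ℕ → ℝ} {k : ℕ} {y : ι} (hM : 0 ≤ M)
    (hH : ∀ X ∈ F₀ k y, ∀ U U' : Bg, |H U X - H U' X| ≤ M * Real.exp (-(κ * C.d X)) * gauge U U')
    (hs : ∀ X ∈ F₀ k y, Integrable (fun ω => w₀ k y X ω * H (bg k s y X ω) X) (ν₀ k y X))
    (hs' : ∀ X ∈ F₀ k y, Integrable (fun ω => w₀ k y X ω * H (bg k s' y X ω) X) (ν₀ k y X))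
    (hwa : ∀ X ∈ F₀ k y, Integrable (fun ω => |w₀ k y X ω| * amp k y X ω) (ν₀ k y X))
    (hshift : ∀ X ∈ F₀ k y, ∀ ω, gauge (bg k s y X ω) (bg k s' y X ω) ≤ amp k y X ω * |s k - s' k|) :
    |evalChannel (fun k _ y => F₀ k y) (fun k _ y => ν₀ k y) (fun k _ y => w₀ k y) bg k s H y -
        evalChannel (fun k _ y => F₀ k y) (fun k _ y => ν₀ k y) (fun k _ y => w₀ k y) bg k s' H y| ≤
      (∑ X ∈ F₀ k y, Real.exp (-(κ * C.d X)) * ∫ ω, |w₀ k y X ω| * amp k y X ω ∂(ν₀ k y X)) *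
        (M * |s k - s' k|) := by
  simp only [evalChannel]
  rw [← Finset.sum_sub_distrib]
  calc |∑ X ∈ F₀ k y, ((∫ ω, w₀ k y X ω * H (bg k s y X ω) X ∂(ν₀ k y X)) -
            ∫ ω, w₀ k y X ω * H (bg k s' y X ω) X ∂(ν₀ k y X))|
      ≤ ∑ X ∈ F₀ k y, |(∫ ω, w₀ k y X ω * H (bg k s y X ω) X ∂(ν₀ k y X)) -
            ∫ ω, w₀ k y X ω * H (bg k s' y X ω) X ∂(ν₀ k y X)| := Finset.abs_sum_le_sum_abs _ _
    _ ≤ ∑ X ∈ F₀ k y, (∫ ω, |w₀ k y X ω| * amp k y X ω ∂(ν₀ k y X)) *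
            (M * Real.exp (-(κ * C.d X)) * |s k - s' k|) := by
        refine Finset.sum_le_sum fun X hX => ?_
        refine abs_integral_mul_sub_le_of_shift (hs X hX) (hs' X hX) (hwa X hX) fun ω => ?_
        have he : 0 ≤ M * Real.exp (-(κ * C.d X)) := mul_nonneg hM (Real.exp_pos _).le
        calc |H (bg k s y X ω) X - H (bg k s' y X ω) X|
            ≤ M * Real.exp (-(κ * C.d X)) * gauge (bg k s y X ω) (bg k s' y X ω) := hH X hX _ _
          _ ≤ M * Real.exp (-(κ * C.d X)) * (amp k y X ω * |s k - s' k|) :=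
              mul_le_mul_of_nonneg_left (hshift X hX ω) he
          _ = M * Real.exp (-(κ * C.d X)) * |s k - s' k| * amp k y X ω := by ring
    _ = (∑ X ∈ F₀ k y, Real.exp (-(κ * C.d X)) * ∫ ω, |w₀ k y X ω| * amp k y X ω ∂(ν₀ k y X)) *
          (M * |s k - s' k|) := by
        rw [Finset.sum_mul]
        refine Finset.sum_congr rfl fun X _ => ?_
        ring

/-- **THE `hTcup` CLAUSE FOR AN EVALUATION–INTEGRAL CHANNEL (kernel; the theorem of this leaf).**  For a history-indexed
family `H g` (the terms `E g`, or a projected family `P (E g)`), integrable along the evaluation families (`hH`), with a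
UNIFORM background modulus `CUbar` in the `e^{−κd}` currency (`hLip`, displayed — for `H = E` on run-A backgrounds this is
`T4OutputRate.LipBackground`, §2), the displayed SHIFT bound `hshift` (histories of the window move the evaluated background by
at most `amp·|g k − g′ k|` in the gauge — the comparison history enters the step-k kernel only through its k-th coupling) and
the kernel SHIFT-MASS inequality `hmass` (decay-weighted `∫|w₀|·amp` over the source domains ≤ `wt k y·qA k`): the channel
outputs at two coupling ARGUMENTS on the SAME family differ by at most `wt k y·(CUbar·qA k·|g k − g′ k|)` — LITERALLY the
binder `hTcup` of the row's END faces with `qT k := CUbar·qA k`.  Printed TYPES: [I] (2.12)–(2.13) p. 268 (shift amplitude);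
[II] (1.21)–(1.24) p. 7 (shift size × weight mass), (1.36) p. 9 (the weight `wt k y`).
[cite: Balaban1987RG1, (2.12)-(2.13) p.268; Balaban1988RG2Cluster, (1.21)-(1.24) p.7, (1.36) p.9] -/
theorem channelCouplingModulus_eval {W : Set (ℕ → ℝ)} {H : (ℕ → ℝ) → Bg → C.Dom → ℝ}
    {F₀ : ℕ → ι → Finset C.Dom} {ν₀ : ℕ → ι → C.Dom → Measure Ω} {w₀ : ℕ → ι → C.Dom → Ω → ℝ}
    {bg : ℕ → (ℕ → ℝ) → ι → C.Dom → Ω → Bg} (gauge : Bg → Bg → ℝ) {amp : ℕ → ι → C.Dom → Ω → ℝ}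
    {κ CUbar : ℝ} {wt : ℕ → ι → ℝ} {qA : ℕ → ℝ}
    (hH : ∀ g ∈ W, H g ∈ EvalAdm (fun k _ y => F₀ k y) (fun k _ y => ν₀ k y) (fun k _ y => w₀ k y) bg)
    (hCU0 : 0 ≤ CUbar)
    (hLip : ∀ g ∈ W, ∀ (U U' : Bg) (X : C.Dom),
      |H g U X - H g U' X| ≤ CUbar * Real.exp (-(κ * C.d X)) * gauge U U')
    (hwa : ∀ (k : ℕ) (y : ι), ∀ X ∈ F₀ k y, Integrable (fun ω => |w₀ k y X ω| * amp k y X ω) (ν₀ k y X))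
    (hshift : ∀ g ∈ W, ∀ g' ∈ W, ∀ (k : ℕ) (y : ι), ∀ X ∈ F₀ k y, ∀ ω,
      gauge (bg k g y X ω) (bg k g' y X ω) ≤ amp k y X ω * |g k - g' k|)
    (hmass : ∀ (k : ℕ) (y : ι),
      ∑ X ∈ F₀ k y, Real.exp (-(κ * C.d X)) * ∫ ω, |w₀ k y X ω| * amp k y X ω ∂(ν₀ k y X) ≤ wt k y * qA k) :
    ∀ g ∈ W, ∀ g' ∈ W, ∀ (k : ℕ) (y : ι),
      |evalChannel (fun k _ y => F₀ k y) (fun k _ y => ν₀ k y) (fun k _ y => w₀ k y) bg k g (H g) y -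
          evalChannel (fun k _ y => F₀ k y) (fun k _ y => ν₀ k y) (fun k _ y => w₀ k y) bg k g' (H g) y| ≤
        wt k y * (CUbar * qA k * |g k - g' k|) := by
  intro g hg g' hg' k y
  have h := abs_evalChannel_sub_le_of_shift (bg := bg) gauge (s := g) (s' := g') hCU0
    (fun X _ U U' => hLip g hg U U' X) ((hH g hg) k g y) ((hH g hg) k g' y) (hwa k y)
    (fun X hX ω => hshift g hg g' hg' k y X hX ω)
  have hnn : 0 ≤ CUbar * |g k - g' k| := mul_nonneg hCU0 (abs_nonneg _)
  calc |evalChannel (fun k _ y => F₀ k y) (fun k _ y => ν₀ k y) (fun k _ y => w₀ k y) bg k g (H g) y -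
          evalChannel (fun k _ y => F₀ k y) (fun k _ y => ν₀ k y) (fun k _ y => w₀ k y) bg k g' (H g) y|
      ≤ (∑ X ∈ F₀ k y, Real.exp (-(κ * C.d X)) * ∫ ω, |w₀ k y X ω| * amp k y X ω ∂(ν₀ k y X)) *
          (CUbar * |g k - g' k|) := h
    _ ≤ wt k y * qA k * (CUbar * |g k - g' k|) := mul_le_mul_of_nonneg_right (hmass k y) hnn
    _ = wt k y * (CUbar * qA k * |g k - g' k|) := by ring

/-! ## §2 The terms on run-A backgrounds: `LipBackground` BY NAME -/

/-- **`hTcup` FROM `T4OutputRate.LipBackground` (kernel).**  For run-A backgrounds (`Bg = C.BgA`, the carrier's gauge), node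
U3's printed-ingredient bracket `LipBackground E W κ CU` (displayed; [III] (2.27)(ii) + (1.18) + Cauchy, NOT carried out in the
tree) with `CU g j ≤ CUbar` on the window, the shift bound and the kernel shift mass give the END's `hTcup` clause for the
evaluation–integral channel with `qT k := CUbar·qA k`.
[cite: Balaban1988Convergent, (2.27)-(2.28) p.259; Balaban1987RG1, (2.12)-(2.13) p.268; Balaban1988RG2Cluster, (1.24) p.7] -/
theorem channelCouplingModulus_eval_of_lipBackground {E : Functional C C.BgA} {W : Set (ℕ → ℝ)}
    {F₀ : ℕ → ι → Finset C.Dom} {ν₀ : ℕ → ι → C.Dom → Measure Ω} {w₀ : ℕ → ι → C.Dom → Ω → ℝ}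
    {bg : ℕ → (ℕ → ℝ) → ι → C.Dom → Ω → C.BgA} {amp : ℕ → ι → C.Dom → Ω → ℝ}
    {κ CUbar : ℝ} {CU : (ℕ → ℝ) → ℕ → ℝ} {wt : ℕ → ι → ℝ} {qA : ℕ → ℝ}
    (hE : ∀ g ∈ W, E g ∈ EvalAdm (fun k _ y => F₀ k y) (fun k _ y => ν₀ k y) (fun k _ y => w₀ k y) bg)
    (hLB : LipBackground E W κ CU) (hCU : ∀ g ∈ W, ∀ j, CU g j ≤ CUbar) (hCU0 : 0 ≤ CUbar)
    (hwa : ∀ (k : ℕ) (y : ι), ∀ X ∈ F₀ k y, Integrable (fun ω => |w₀ k y X ω| * amp k y X ω) (ν₀ k y X))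
    (hshift : ∀ g ∈ W, ∀ g' ∈ W, ∀ (k : ℕ) (y : ι), ∀ X ∈ F₀ k y, ∀ ω,
      C.gauge (bg k g y X ω) (bg k g' y X ω) ≤ amp k y X ω * |g k - g' k|)
    (hmass : ∀ (k : ℕ) (y : ι),
      ∑ X ∈ F₀ k y, Real.exp (-(κ * C.d X)) * ∫ ω, |w₀ k y X ω| * amp k y X ω ∂(ν₀ k y X) ≤ wt k y * qA k) :
    ∀ g ∈ W, ∀ g' ∈ W, ∀ (k : ℕ) (y : ι),
      |evalChannel (fun k _ y => F₀ k y) (fun k _ y => ν₀ k y) (fun k _ y => w₀ k y) bg k g (E g) y -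
          evalChannel (fun k _ y => F₀ k y) (fun k _ y => ν₀ k y) (fun k _ y => w₀ k y) bg k g' (E g) y| ≤
        wt k y * (CUbar * qA k * |g k - g' k|) := by
  refine channelCouplingModulus_eval (H := E) C.gauge hE hCU0 (fun g hg U U' X => ?_) hwa hshift hmass
  calc |E g U X - E g U' X| ≤ CU g (C.scale X) * Real.exp (-(κ * C.d X)) * C.gauge U U' := hLB g hg U U' X
    _ ≤ CUbar * Real.exp (-(κ * C.d X)) * C.gauge U U' :=
        mul_le_mul_of_nonneg_right (mul_le_mul_of_nonneg_right (hCU g hg _) (Real.exp_pos _).le)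
          (C.gauge_nonneg _ _)

/-! ## §3 END-B with an evaluation–integral channel: the channel side reduced to two kernel inequalities + a background modulus -/

section EndFace

variable (G : ClusterGeom C) {Pot : Type*} [NormedAddCommGroup Pot] [NormedSpace ℂ Pot]

/-- **NE9 ∧ FADING MEMORY, COUPLING TWO-POINT END WITH AN EVALUATION–INTEGRAL CHANNEL (kernel end-to-end).**  END-B
`NE9LastCouplingBridge.ne9_and_fadingMemory_of_couplingTwoPoint` APPLIED BY NAME at
`T := evalChannel (coupling-free kernel F₀, ν₀, w₀; shifted backgrounds bg)` with: the five channel STRUCTURE∕SIZE binders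
`AdmissibleTerms`∕`AdmRestrict`∕`ChannelAdditive`∕`ChannelStepSum`∕`ChannelSizeAtStepNN` REPLACED by the co-owner's P2-F2 data —
integrability of the terms along the families (`hE`), locality of the source domains (`hF`), integrable weights (`hw`), the
kernel-MASS inequality (`hmass`) — and the CHANNEL COUPLING MODULUS `hTcup` (with `hqT0`, `hqTb`) REPLACED by §1's data — the
terms' background modulus `CUbar` (`hLip`; = `LipBackground` on run-A backgrounds, §2), the shift bound (`hshift`), the kernel
SHIFT-MASS inequality (`hampMass`, constants `qA k ≤ qAbar`).  Every other binder of END-B VERBATIM (activities' `TwoPointKP`,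
`hCup`, representation `hrepr`, explicit part `hexpl`, geometry `hdec`∕`hpin`, reading `hρ`, occupation `hocc`, scalars);
conclusion = END-B's with `qTbar := CUbar·qAbar`.  Nothing of [I]–[III] asserted; NE9 NOT PROVED; 0∕9 unchanged.
[cite: Balaban1987RG1, (2.12)-(2.13) p.268; Balaban1988RG2Cluster, (1.21)-(1.24) p.7, (1.33)-(1.36) p.9, Lemma 3 (2.38) p.20] -/
theorem ne9_and_fadingMemory_of_couplingTwoPoint_evalChannel {E : Functional C Bg} {W : Set (ℕ → ℝ)}
    {F₀ : ℕ → ι → Finset C.Dom} {ν₀ : ℕ → ι → C.Dom → Measure Ω} {w₀ : ℕ → ι → C.Dom → Ω → ℝ}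
    {bg : ℕ → (ℕ → ℝ) → ι → C.Dom → Ω → Bg} (gauge : Bg → Bg → ℝ) {amp : ℕ → ι → C.Dom → Ω → ℝ}
    {Ψ : ℕ → ℝ → (ι → ℝ) → Bg → C.Dom → ℝ} {act : ℕ → ℝ → Bg → Pot → G.P → ℂ} {𝒜 : ℕ → Set Pot}
    {n : ℕ → ℝ → Bg → G.P → ℝ} {lip clip : ℕ → ℝ} {a d : G.P → ℝ} {δ : C.Dom → ℝ}
    {κ B lipbar clipbar pexbar CUbar qAbar τbar ω : ℝ} {wt : ℕ → ι → ℝ} {τ : ℕ → ℕ → ℝ} {pex qA : ℕ → ℝ}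
    (ρ : ℕ → (ι → ℝ) → Pot) (expl : ℕ → ℝ → Bg → C.Dom → ℝ) (h0 : ScaleZeroFree E W)
    -- the channel: evaluation–integral with coupling-free kernel (P2-F2's binders)
    (hE : ∀ g ∈ W, E g ∈ EvalAdm (fun k _ y => F₀ k y) (fun k _ y => ν₀ k y) (fun k _ y => w₀ k y) bg)
    (hF : ∀ (k : ℕ) (y : ι), ∀ X ∈ F₀ k y, C.scale X ≤ k)
    (hw : ∀ (k : ℕ) (y : ι), ∀ X ∈ F₀ k y, Integrable (w₀ k y X) (ν₀ k y X))
    (hmass : ∀ (k j : ℕ) (y : ι),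
      ∑ X ∈ (F₀ k y).filter (fun X => C.scale X = j),
          Real.exp (-(κ * C.d X)) * ∫ ω, |w₀ k y X ω| ∂(ν₀ k y X) ≤ wt k y * τ k j)
    (hfac : Factorises E W (evalChannel (fun k _ y => F₀ k y) (fun k _ y => ν₀ k y) (fun k _ y => w₀ k y) bg) Ψ)
    -- the activities' coupling two-point clause (END-B, verbatim)
    (hclip0 : ∀ k, 0 ≤ clip k)
    (hCup : ∀ g ∈ W, ∀ g' ∈ W, ∀ (k : ℕ) (U : Bg) (X : C.Dom), C.scale X = k + 1 → ∀ Q ∈ 𝒜 k, ∀ γ ∈ G.vol X,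
      ‖act k (g k) U Q γ‖ ≤ n k (g' k) U γ ∧
        ‖act k (g k) U Q γ - act k (g' k) U Q γ‖ ≤ clip k * |g k - g' k| * n k (g' k) U γ)
    -- the channel coupling modulus REPLACED by: background modulus + shift bound + shift mass (§1)
    (hCU0 : 0 ≤ CUbar)
    (hLip : ∀ g ∈ W, ∀ (U U' : Bg) (X : C.Dom),
      |E g U X - E g U' X| ≤ CUbar * Real.exp (-(κ * C.d X)) * gauge U U')
    (hwa : ∀ (k : ℕ) (y : ι), ∀ X ∈ F₀ k y, Integrable (fun ω => |w₀ k y X ω| * amp k y X ω) (ν₀ k y X))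
    (hshift : ∀ g ∈ W, ∀ g' ∈ W, ∀ (k : ℕ) (y : ι), ∀ X ∈ F₀ k y, ∀ ω,
      gauge (bg k g y X ω) (bg k g' y X ω) ≤ amp k y X ω * |g k - g' k|)
    (hampMass : ∀ (k : ℕ) (y : ι),
      ∑ X ∈ F₀ k y, Real.exp (-(κ * C.d X)) * ∫ ω, |w₀ k y X ω| * amp k y X ω ∂(ν₀ k y X) ≤ wt k y * qA k)
    (hqA0 : ∀ k, 0 ≤ qA k) (hqAb : ∀ k, qA k ≤ qAbar)
    -- representation and explicit part (END-B, verbatim)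
    (hrepr : ∀ (k : ℕ) (s : ℝ) (P : ι → ℝ) (U : Bg) (X : C.Dom),
      Ψ k s P U X = (G.newTerm act k s U X (ρ k P)).re + expl k s U X)
    (hexpl : ∀ g ∈ W, ∀ g' ∈ W, ∀ (k : ℕ) (U : Bg) (X : C.Dom), C.scale X = k + 1 →
      |expl k (g k) U X - expl k (g' k) U X| ≤ Real.exp (-(κ * C.d X)) * (pex k * |g k - g' k|))
    (hclipb : ∀ k, clip k ≤ clipbar) (hpexb : ∀ k, pex k ≤ pexbar) (hpexbar : 0 ≤ pexbar)
    -- the table channel and the common data (P2, verbatim)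
    (hK : TwoPointKP G W act 𝒜 n lip a d) (hdec : G.DecayExtract δ d) (hpin : G.PinBudget a δ (fun _ => B) κ)
    (hρ : ∀ (k : ℕ) (P P' : ι → ℝ) (M : ℝ), (∀ y, |P y - P' y| ≤ wt k y * M) → ‖ρ k P - ρ k P'‖ ≤ M)
    (hocc : ∀ g ∈ W, ∀ g' ∈ W, ∀ k : ℕ,
      ρ k (evalChannel (fun k _ y => F₀ k y) (fun k _ y => ν₀ k y) (fun k _ y => w₀ k y) bg k g' (E g)) ∈ 𝒜 k)
    (hB : 0 ≤ B) (hlipb : ∀ k, lip k ≤ lipbar) (hτbar : 0 ≤ τbar) (hω : 0 ≤ ω) (hpos : 0 < ω + 4 * lipbar * B * τbar)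
    (hτ : ∀ k j, j ≤ k → 0 ≤ τ k j ∧ τ k j ≤ τbar * ω ^ (k - j)) :
    NE9 E W κ (prodModuli (4 * clipbar * B + pexbar + 4 * lipbar * B * (CUbar * qAbar))
        fun _ => ω + 4 * lipbar * B * τbar) ∧
      FadingMemory ((4 * clipbar * B + pexbar + 4 * lipbar * B * (CUbar * qAbar)) / (ω + 4 * lipbar * B * τbar))
        (ω + 4 * lipbar * B * τbar)
        (prodModuli (4 * clipbar * B + pexbar + 4 * lipbar * B * (CUbar * qAbar))
          fun _ => ω + 4 * lipbar * B * τbar) :=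
  ne9_and_fadingMemory_of_couplingTwoPoint G (qT := fun k => CUbar * qA k) ρ expl h0 (admissibleTerms_eval hE)
    admRestrict_eval channelAdditive_eval (channelStepSum_eval fun k _ y => hF k y)
    (channelSizeAtStepNN_of_kernelMass (fun k _ y => hw k y) fun k j _ y => hmass k j y) hfac hclip0 hCup
    (fun k => mul_nonneg hCU0 (hqA0 k)) (channelCouplingModulus_eval (H := E) gauge hE hCU0 hLip hwa hshift hampMass)
    hrepr hexpl hclipb hpexb hpexbar (fun k => mul_le_mul_of_nonneg_left (hqAb k) hCU0) hK hdec hpin hρ hocc hB hlipb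
    hτbar hω hpos hτ

end EndFace

/-! ## §4 Non-vacuity with a genuine shift: coupling-free terms, the coupling created by the evaluated background alone -/

/-- **Non-vacuity of §1 with `qT ≠ 0`.**  Toy carriers (`Dom = ℕ`, `scale = id`, `d = 0`), REAL backgrounds with gauge
`|U − U′|`, coupling-FREE toy terms `(g, U, k) ↦ sin U` (1-Lipschitz in the background), toy evaluation channel = one source
domain `{k}`, Dirac parameter measure on `Unit`, weight `1`, evaluated background = the k-th coupling of the comparison history
(`amp = 1`): §1 gives the `hTcup` clause on the full window with `wt ≡ 1`, `CUbar = 1`, `qA ≡ 1`. [folklore] -/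
theorem toy_channelCouplingModulus :
    ∀ g ∈ (Set.univ : Set (ℕ → ℝ)), ∀ g' ∈ (Set.univ : Set (ℕ → ℝ)), ∀ (k : ℕ) (y : Unit),
      |evalChannel (C := toyCarriers) (Ω := Unit) (fun k _ _ => ({k} : Finset ℕ)) (fun _ _ _ _ => Measure.dirac ())
            (fun _ _ _ _ _ => (1 : ℝ)) (fun k s _ _ _ => s k) k g
            ((fun _ U _ => Real.sin U : Functional toyCarriers ℝ) g) y -
          evalChannel (C := toyCarriers) (Ω := Unit) (fun k _ _ => ({k} : Finset ℕ)) (fun _ _ _ _ => Measure.dirac ())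
            (fun _ _ _ _ _ => (1 : ℝ)) (fun k s _ _ _ => s k) k g'
            ((fun _ U _ => Real.sin U : Functional toyCarriers ℝ) g) y| ≤
        (fun (_ : ℕ) (_ : Unit) => (1 : ℝ)) k y * (1 * (fun _ : ℕ => (1 : ℝ)) k * |g k - g' k|) := by
  refine channelCouplingModulus_eval (C := toyCarriers) (Bg := ℝ)
    (H := (fun _ U _ => Real.sin U : Functional toyCarriers ℝ)) (κ := 0)
    (F₀ := fun k _ => ({k} : Finset ℕ)) (ν₀ := fun _ _ _ => Measure.dirac ()) (w₀ := fun _ _ _ _ => (1 : ℝ))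
    (bg := fun k s _ _ _ => s k) (fun U U' => |U - U'|) (amp := fun _ _ _ _ => (1 : ℝ))
    (fun g _ k s y X _ => ?_) zero_le_one (fun g _ U U' X => ?_) (fun k y X _ => ?_) (fun g _ g' _ k y X _ ω => ?_)
    (fun k y => ?_)
  · exact Integrable.of_finite
  · simpa [toyCarriers] using Real.abs_sin_sub_sin_le U U'
  · exact Integrable.of_finite
  · simp
  · simp [toyCarriers]

/-- The toy clause is NOT vacuous: the channel output difference IS `sin(g k) − sin(g′ k)` (e.g. `= 1` at `g k = π∕2`,
`g′ k = 0`), although the toy terms do not depend on the couplings. [folklore] -/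
example (k : ℕ) (g g' : ℕ → ℝ) :
    evalChannel (C := toyCarriers) (Ω := Unit) (fun k _ _ => ({k} : Finset ℕ)) (fun _ _ _ _ => Measure.dirac ())
          (fun _ _ _ _ _ => (1 : ℝ)) (fun k s _ _ _ => s k) k g ((fun _ U _ => Real.sin U : Functional toyCarriers ℝ) g) () -
        evalChannel (C := toyCarriers) (Ω := Unit) (fun k _ _ => ({k} : Finset ℕ)) (fun _ _ _ _ => Measure.dirac ())
          (fun _ _ _ _ _ => (1 : ℝ)) (fun k s _ _ _ => s k) k g' ((fun _ U _ => Real.sin U : Functional toyCarriers ℝ) g) () =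
      Real.sin (g k) - Real.sin (g' k) := by
  simp [evalChannel]

end Summit.QuantumFields.BalabanUV.T4Continuum.NE9EvalChannelCouplingModulus

end
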